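import Summits.NavierStokesRegularity.NavierStokesRegularity.Theorems.WakeRatchetEternalViscousRateStubNormalise
import Summits.NavierStokesRegularity.NavierStokesRegularity.Theorems.WakeRatchetEternalViscousRateDissipativeRung
import Summits.NavierStokesRegularity.NavierStokesRegularity.Theorems.WakeRatchetEternalViscousRate.Negative.EternalViscousRateFalseOfViscousBlockDSSWaves

/-!
# Crux `WakeRatchet.EternalViscousRate` (⟨stmt-NavierStokesRegularity-25647⟩): the registered skeleton's ONLY open stub
# `stub_inertial` is KERNEL-EQUIVALENT to the crux (bare-EQUIV residual), and inherits its negative lemma BY TEXT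

The registered skeleton `dissipation_edge_line.lean` (842b1374, LINE g9-2) has two stubs: `stub_normalise : StubNormalise` (LANDED,
`DissipationEdge.stub_normalise`, p675351) and `stub_inertial : StubInertial` — the crux at base shell `0` in the INERTIAL regime
`M > edgeThreshold α ν̂ = ν̂²/(128(C_A+1)²)`; the dissipative regime `M ≤ edgeThreshold` is the landed `dissipativeRegime` (rate `a = 2`).
The body of `StubInertial` is quoted VERBATIM below as the proposition `InertialSlice` of the statements (no new definition is introduced):
* `eternalViscousRate_of_inertialSlice` — the skeleton's composition `EternalViscousRate_of` with `stub_inertial` as a hypothesis: slice ⇒ crux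
  (landed `stub_normalise` + `dissipativeRegime`, `a := min 2 a_I`, `εs := min 1 ε_I`).
* `inertialSlice_of_eternalViscousRate` — crux ⇒ slice (drop the regime hypothesis, base shell `0`).
* `eternalViscousRate_iff_inertialSlice` — **⟨25647⟩'s open stub ≡ its crux** (kernel `Iff`): the line g9-2 leaves a bare-EQUIV residual;
  closing `stub_inertial` is exactly proving `EternalViscousRate`.
* `inertialSlice_false_of_ViscousBlockDSSWaves` — hence the landed negative lemma (p608789) binds the stub text too:
  `ViscousBlockDSSWaves → ¬ InertialSlice` (the stub is FALSE modulo the construction, not merely the crux).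
MODEL lattice only (Tao 2016 §4 with the covariant viscous coefficient); nothing here is a statement about the Navier–Stokes equations; the
registered stub is neither proved nor refuted; no summit is proved by this file.
[cite: Tao2016AveragedNS, §4 Lemma 4.1 (4.8)–(4.10), (4.3), the viscous equation before Thm. 4.2, §6.4]
-/

noncomputable section

set_option linter.dupNamespace false

open Set Filter Topology
open Literature.Analysis.FluidPDE Literature.Analysis.FluidPDE.TaoCascade
open Summit.NavierStokesRegularity.NavierStokesRegularity.Theorems

namespace Summit.NavierStokesRegularity.NavierStokesRegularity.Cruxes.EternalViscousRate.DissipationEdge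

/-- **slice ⇒ crux** (the skeleton's composition, `stub_inertial` as a hypothesis).  The hypothesis is the body of the registered stub
`StubInertial` of skeleton 842b1374, verbatim.  MODEL lattice only.
[cite: Tao2016AveragedNS, §4 Lemma 4.1 (4.8)–(4.10), (4.3), the viscous equation before Thm. 4.2, §6.4] -/
theorem eternalViscousRate_of_inertialSlice
    (hI : ∀ R : ℝ, 1 ≤ R → ∃ a : ℝ, 1 < a ∧ ∃ εs : ℝ, 0 < εs ∧ ∀ ε₀ : ℝ, 0 < ε₀ → ε₀ ≤ εs →
      ∀ α : Fin 4 → Fin 4 → Fin 4 → ℤ × ℤ × ℤ → ℝ, InTableClass R α →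
      ∀ (νh : ℝ) (W : ℤ → ℝ → Em 4), 0 < νh → IsEternalVisc ε₀ νh α W → UniformBound W →
      ∀ M : ℝ, edgeThreshold α νh < M →
      (∀ σ : ℝ, ∑' k : ℕ, physEnergy ε₀ W (0 + k) σ ≤ M) →
      ∀ σ : ℝ, ∑' k : ℕ, physEnergy ε₀ W (0 + 1 + k) σ ≤ (1 + ε₀) ^ (-a) * M) :
    Summit.NavierStokesRegularity.NavierStokesRegularity.Theses.WakeRatchet.EternalViscousRate := by
  intro R hR
  obtain ⟨aI, haI, εI, hεI, HI⟩ := hI R hR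
  refine ⟨min 2 aI, lt_min (by norm_num) haI, min 1 εI, lt_min one_pos hεI, ?_⟩
  intro ε₀ hε hεs α hα νh W hν hW hUB n M hM σ
  have hε1 : ε₀ ≤ 1 := hεs.trans (min_le_left _ _)
  have hεI' : ε₀ ≤ εI := hεs.trans (min_le_right _ _)
  have h0 : RateAt (min 2 aI) ε₀ α νh 0 := by
    intro W' hW' hUB' M' hM' σ'
    have hM'0 : 0 ≤ M' :=
      (tsum_nonneg fun k : ℕ => physEnergy_nonneg ε₀ W' (0 + (k : ℤ)) σ').trans (hM' σ')
    have hmono : ∀ a : ℝ, min 2 aI ≤ a →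
        (1 + ε₀) ^ (-a) * M' ≤ (1 + ε₀) ^ (-(min 2 aI)) * M' := by
      intro a ha
      apply mul_le_mul_of_nonneg_right _ hM'0
      exact Real.rpow_le_rpow_of_exponent_le (by linarith) (by linarith)
    rcases le_or_gt M' (edgeThreshold α νh) with hle | hlt
    · exact (dissipativeRegime ε₀ hε hε1 α hα.2.1 νh W' hν hW' hUB' M' hle hM' σ').trans
        (hmono 2 (min_le_left _ _))
    · exact (HI ε₀ hε hεI' α hα νh W' hν hW' hUB' M' hlt hM' σ').trans
        (hmono aI (min_le_right _ _))
  exact stub_normalise (min 2 aI) ε₀ α νh n hε hν h0 W hW hUB M hM σ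

/-- **crux ⇒ slice**: the crux at base shell `0`, forgetting the regime hypothesis.  MODEL lattice only.
[cite: Tao2016AveragedNS, §4 Lemma 4.1 (4.8)–(4.10), (4.3), the viscous equation before Thm. 4.2, §6.4] -/
theorem inertialSlice_of_eternalViscousRate
    (hK : Summit.NavierStokesRegularity.NavierStokesRegularity.Theses.WakeRatchet.EternalViscousRate) :
    ∀ R : ℝ, 1 ≤ R → ∃ a : ℝ, 1 < a ∧ ∃ εs : ℝ, 0 < εs ∧ ∀ ε₀ : ℝ, 0 < ε₀ → ε₀ ≤ εs →
      ∀ α : Fin 4 → Fin 4 → Fin 4 → ℤ × ℤ × ℤ → ℝ, InTableClass R α →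
      ∀ (νh : ℝ) (W : ℤ → ℝ → Em 4), 0 < νh → IsEternalVisc ε₀ νh α W → UniformBound W →
      ∀ M : ℝ, edgeThreshold α νh < M →
      (∀ σ : ℝ, ∑' k : ℕ, physEnergy ε₀ W (0 + k) σ ≤ M) →
      ∀ σ : ℝ, ∑' k : ℕ, physEnergy ε₀ W (0 + 1 + k) σ ≤ (1 + ε₀) ^ (-a) * M := by
  intro R hR
  obtain ⟨a, ha, εs, hεs, H⟩ := hK R hR
  exact ⟨a, ha, εs, hεs, fun ε₀ hε₀ hle α hα νh W hν hW hU M _ hM σ =>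
    H ε₀ hε₀ hle α hα νh W hν hW hU 0 M hM σ⟩

/-- **⟨25647⟩'s open stub ≡ its crux.**  `EternalViscousRate ↔ InertialSlice` (the body of `StubInertial`, skeleton 842b1374, verbatim):
the line g9-2 is a bare-EQUIV residual once `stub_normalise` and the dissipative rung are in.  MODEL lattice only.
[cite: Tao2016AveragedNS, §4 Lemma 4.1 (4.8)–(4.10), (4.3), the viscous equation before Thm. 4.2, §6.4] -/
theorem eternalViscousRate_iff_inertialSlice :
    Summit.NavierStokesRegularity.NavierStokesRegularity.Theses.WakeRatchet.EternalViscousRate ↔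
    (∀ R : ℝ, 1 ≤ R → ∃ a : ℝ, 1 < a ∧ ∃ εs : ℝ, 0 < εs ∧ ∀ ε₀ : ℝ, 0 < ε₀ → ε₀ ≤ εs →
      ∀ α : Fin 4 → Fin 4 → Fin 4 → ℤ × ℤ × ℤ → ℝ, InTableClass R α →
      ∀ (νh : ℝ) (W : ℤ → ℝ → Em 4), 0 < νh → IsEternalVisc ε₀ νh α W → UniformBound W →
      ∀ M : ℝ, edgeThreshold α νh < M →
      (∀ σ : ℝ, ∑' k : ℕ, physEnergy ε₀ W (0 + k) σ ≤ M) →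
      ∀ σ : ℝ, ∑' k : ℕ, physEnergy ε₀ W (0 + 1 + k) σ ≤ (1 + ε₀) ^ (-a) * M) :=
  ⟨inertialSlice_of_eternalViscousRate, eternalViscousRate_of_inertialSlice⟩

/-- **The negative lemma binds the stub text.**  `ViscousBlockDSSWaves → ¬ InertialSlice`: the registered stub `stub_inertial` of
⟨25647⟩ is false modulo the construction `ViscousBlockDSSWaves` (landed `WakeRatchetViscDSS.EternalViscousRate_false_of_ViscousBlockDSSWaves`,
p608789), exactly like its crux.  No verdict changes (the construction is open).  MODEL lattice only.
[cite: Tao2016AveragedNS, §4, the viscous equation before Thm. 4.2, §6.4] -/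
theorem inertialSlice_false_of_ViscousBlockDSSWaves (hH : WakeRatchetViscDSS.ViscousBlockDSSWaves) :
    ¬ (∀ R : ℝ, 1 ≤ R → ∃ a : ℝ, 1 < a ∧ ∃ εs : ℝ, 0 < εs ∧ ∀ ε₀ : ℝ, 0 < ε₀ → ε₀ ≤ εs →
      ∀ α : Fin 4 → Fin 4 → Fin 4 → ℤ × ℤ × ℤ → ℝ, InTableClass R α →
      ∀ (νh : ℝ) (W : ℤ → ℝ → Em 4), 0 < νh → IsEternalVisc ε₀ νh α W → UniformBound W →
      ∀ M : ℝ, edgeThreshold α νh < M →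
      (∀ σ : ℝ, ∑' k : ℕ, physEnergy ε₀ W (0 + k) σ ≤ M) →
      ∀ σ : ℝ, ∑' k : ℕ, physEnergy ε₀ W (0 + 1 + k) σ ≤ (1 + ε₀) ^ (-a) * M) :=
  fun hI => WakeRatchetViscDSS.EternalViscousRate_false_of_ViscousBlockDSSWaves hH
    (eternalViscousRate_of_inertialSlice hI)

end Summit.NavierStokesRegularity.NavierStokesRegularity.Cruxes.EternalViscousRate.DissipationEdge

end
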